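import Mathlib

/-!
# `Balaban1983to89.B5Eq129CycleKernelRootLetters` — T. Bałaban, *Propagators and renormalization transformations for lattice gauge theories. I*, Commun. Math.
# Phys. **95** (1984) 17–40 [Balaban1984PropagatorsI] (1.29) p. 23: **THE ROOT LETTERS OF THE MASSIVE CYCLE KERNEL — for the small root `q ∈ (0,1)` of
# `q + q⁻¹ = 2 + μ∕t²` (the decay rate per site of the one-dimensional resolvent `(t²(−Δ) + μ)⁻¹`): `(1 − q)² = qμ∕t²`, `q∕(1 − q) ≤ t∕√μ`, the finite-period
# factor `(1 + qⁿ)∕(1 − qⁿ) ≤ 1 + 2q∕(n(1 − q))`, hence `(1 + qⁿ)∕((1 − qⁿ)√(μ² + 4μt²)) ≤ (1 + 2t∕(n√μ))∕√(μ² + 4μt²)`** — the arithmetic that turns the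
# closed form `G(0) = (1 + qⁿ)∕((1 − qⁿ)√(μ² + 4μt²))` of the cycle kernel at the source (`B5Eq129FreeResolventCycleProfile.cycle_profile_eq` with `root_const_eq`)
# into a letter WITHOUT `q`, explicit in the period `n`; consumed by `B5Eq129FreeResolventWeightedGradientRowCosh` §4 (storey J (K∇) of the pub-balaban NE9 chain,
# row L13).  In the units `t = η⁻¹`: `1∕√(μ² + 4μt²) = η∕√(4μ + μ²η²)` and `2t∕(n√μ) = 2∕(L√μ)`, `L = nη` the physical period

statement-level skeleton of published theorems with citation tags; proofs where landed; nothing here is a claim about the Yang–Mills mass gap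

CITATION HEADER (lean-in-tree rule).  Audit cell `pub-balaban`, sub-cell `t4`, BINDER row NE9; filed by NE9 crux-team LEAF PROVER 05
(`b2b-balaban-t4-ne9-formalise-leaf-05`, gen 81).  OBJECT: the characteristic equation `q + q⁻¹ = 2 + μ∕t²` of [Balaban1984PropagatorsI] (1.29)'s one-dimensional
stencil (as a HYPOTHESIS on a real number `q`; no `def`).  CONTENT: [folklore] real arithmetic (Mathlib only).  Nothing of print is asserted.

WHAT IS PROVED (sorry-free; proof lane — 0 `def`; imports `Mathlib` only ⇒ lane-independent).
* **`one_sub_root_sq`** — `(1 − q)² = qμ∕t²`; **`root_div_one_sub_le`** — `q∕(1 − q) ≤ t∕√μ` (`t > 0`, `μ > 0`, `0 < q < 1`).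
* **`n_mul_pow_mul_le`** — `n·qⁿ·(1 − q) ≤ q·(1 − qⁿ)` (`0 ≤ q ≤ 1`); **`one_add_pow_div_le`** — `(1 + qⁿ)∕(1 − qⁿ) ≤ 1 + 2q∕(n(1 − q))` (`n ≥ 1`).
* **`closedForm_apply_zero_le`** — `(1 + qⁿ)∕((1 − qⁿ)·√(μ² + 4μt²)) ≤ (1 + 2t∕(n·√μ))∕√(μ² + 4μt²)`.
* §4 **`tendsto_finitePeriod_factor`** — `(1 + qⁿ)∕(1 − qⁿ) → 1` as `n → ∞` (`0 ≤ q < 1`): the finite-period factor disappears in the infinite-period limit (the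
  first of t4-ne9-idea-1 g129's two un-typed limit letters, for the `G(0)` term only; N23's `S^{cosh}`∕`S^{ctr}` themselves are NOT asserted).
HONEST SCOPE.  Arithmetic of one real root; no kernel, no torus.  ONE input of ONE letter of ONE un-opened storey (J) of row L13; NOT NE9 (cell pub-balaban: NE9 NOT
PRINTED ∕ NOT PROVED; «NE9 ⇐ the named binders»; row WALLED ON A MODEL (O-NE9-1; #5 UNRULED); spine PROVED 0∕9; rung (B)+1 finite T⁴ — NOT infinite volume, NOT
mass gap, NOT BetaPertH, NOT Clay).  HONEST DEPENDENCY: continuum YM on T⁴ ⇐ BetaPertH ∧ nine spine estimates (0/9 proved); BetaPertH ⇐ (D1) ∧ (D4) ∧ CAP+tail;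
G-an2-4 gates asym, D1 and NE2/3/4.  NEW file; nothing modified.  Net new unproved facts: 0.
-/

noncomputable section

open scoped BigOperators
open Filter Topology

namespace Literature.MathematicalPhysics.QuantumFieldTheory.Balaban1983to89.B5Eq129CycleKernelRootLetters

/-! ## §1 The characteristic equation squared; the root against the mass -/

/-- `(1 − q)² = qμ∕t²` for a root of `q + q⁻¹ = 2 + μ∕t²` (`q > 0`, `t ≠ 0`). [folklore] [cite: Balaban1984PropagatorsI, (1.29) p.23] -/
theorem one_sub_root_sq (t : ℝ) (ht : t ≠ 0) {μ q : ℝ} (hq0 : 0 < q) (hq : q + q⁻¹ = 2 + μ / t ^ 2) :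
    (1 - q) ^ 2 = q * μ / t ^ 2 := by
  have hq' : q ≠ 0 := hq0.ne'
  field_simp at hq
  field_simp
  nlinarith [hq]

/-- `q∕(1 − q) ≤ t∕√μ` for the small root (`(1 − q)² = qμ∕t²` and `q ≤ √q`): the inverse decay rate per site is at most the correlation length `t∕√μ`.
[folklore] [cite: Balaban1984PropagatorsI, (1.29) p.23] -/
theorem root_div_one_sub_le (t : ℝ) (ht : 0 < t) {μ q : ℝ} (hμ : 0 < μ) (hq0 : 0 < q) (hq1 : q < 1)
    (hq : q + q⁻¹ = 2 + μ / t ^ 2) : q / (1 - q) ≤ t / Real.sqrt μ := by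
  have h1q : 0 < 1 - q := by linarith
  have hsq := one_sub_root_sq t ht.ne' hq0 hq
  have hsμ : 0 < Real.sqrt μ := Real.sqrt_pos.mpr hμ
  rw [div_le_div_iff₀ h1q hsμ]
  have h3 : (q * Real.sqrt μ) ^ 2 ≤ (t * (1 - q)) ^ 2 := by
    rw [mul_pow, mul_pow, Real.sq_sqrt hμ.le, hsq]
    field_simp
    nlinarith [mul_pos hq0 hμ]
  nlinarith [sq_nonneg (q * Real.sqrt μ - t * (1 - q)), sq_nonneg (q * Real.sqrt μ + t * (1 - q)),
    mul_pos hq0 hsμ, mul_pos ht h1q, abs_le_abs h3]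

/-! ## §2 The finite-period factor -/

/-- `n·qⁿ·(1 − q) ≤ q·(1 − qⁿ)` for `0 ≤ q ≤ 1` (each of the `n` terms of `q + q² + ⋯ + qⁿ` is `≥ qⁿ`). [folklore] [cite: Balaban1984PropagatorsI, (1.29) p.23] -/
theorem n_mul_pow_mul_le {q : ℝ} (hq0 : 0 ≤ q) (hq1 : q ≤ 1) (n : ℕ) : (n : ℝ) * q ^ n * (1 - q) ≤ q * (1 - q ^ n) := by
  have hgeom : q * (1 - q ^ n) = (1 - q) * ∑ i ∈ Finset.range n, q ^ (i + 1) := by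
    rw [← geom_sum_mul_neg q n, Finset.mul_sum, Finset.sum_mul, Finset.mul_sum]
    exact Finset.sum_congr rfl fun i _ => by ring
  have hsum : (n : ℝ) * q ^ n ≤ ∑ i ∈ Finset.range n, q ^ (i + 1) := by
    have : ∑ _i ∈ Finset.range n, q ^ n ≤ ∑ i ∈ Finset.range n, q ^ (i + 1) :=
      Finset.sum_le_sum fun i hi => by
        rw [Finset.mem_range] at hi
        exact pow_le_pow_of_le_one hq0 hq1 (by omega)
    simpa [Finset.sum_const, Finset.card_range] using this
  rw [hgeom]
  have h1q : 0 ≤ 1 - q := by linarith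
  nlinarith [mul_le_mul_of_nonneg_left hsum h1q]

/-- **THE FINITE-PERIOD FACTOR**: `(1 + qⁿ)∕(1 − qⁿ) ≤ 1 + 2q∕(n(1 − q))` for `q ∈ (0,1)`, `n ≥ 1` (it is `1 + 2qⁿ∕(1 − qⁿ)` and `1 − qⁿ ≥ n·qⁿ⁻¹·q·(1 − q)∕q`…,
i.e. `n_mul_pow_mul_le`). [folklore] [cite: Balaban1984PropagatorsI, (1.29) p.23] -/
theorem one_add_pow_div_le {q : ℝ} (hq0 : 0 < q) (hq1 : q < 1) {n : ℕ} (hn : 1 ≤ n) :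
    (1 + q ^ n) / (1 - q ^ n) ≤ 1 + 2 * q / (n * (1 - q)) := by
  have hqn : 0 < 1 - q ^ n := by
    have := pow_lt_one₀ hq0.le hq1 (by omega : n ≠ 0); linarith
  have h1q : 0 < 1 - q := by linarith
  have hn' : (0 : ℝ) < n := by exact_mod_cast hn
  have key := n_mul_pow_mul_le hq0.le hq1.le n
  rw [div_le_iff₀ hqn]
  have e : (1 + 2 * q / (n * (1 - q))) * (1 - q ^ n) = (1 - q ^ n) + 2 * (q * (1 - q ^ n)) / (n * (1 - q)) := by
    field_simp
  rw [e]
  have h2 : 2 * q ^ n ≤ 2 * (q * (1 - q ^ n)) / (n * (1 - q)) := by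
    rw [le_div_iff₀ (by positivity)]
    nlinarith
  linarith

/-! ## §3 The source value of the cycle kernel without `q` -/

/-- **THE CLOSED FORM AT THE SOURCE, WITHOUT `q` AND EXPLICIT IN THE PERIOD**: for `t > 0`, `μ > 0`, the small root `q ∈ (0,1)` of `q + q⁻¹ = 2 + μ∕t²` and
`n ≥ 1`: `(1 + qⁿ)∕((1 − qⁿ)·√(μ² + 4μt²)) ≤ (1 + 2t∕(n·√μ))∕√(μ² + 4μt²)` — the left side is `G(0)` of the cycle kernel on `ℤ∕n`
(`B5Eq129FreeResolventCycleProfile.cycle_profile_eq` + `root_const_eq`).  In the units `t = η⁻¹`: `≤ (1 + 2∕(L√μ))·η∕√(4μ + μ²η²)`, `L = nη`.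
[folklore] [cite: Balaban1984PropagatorsI, (1.29) p.23] -/
theorem closedForm_apply_zero_le (t : ℝ) (ht : 0 < t) {μ : ℝ} (hμ : 0 < μ) {q : ℝ} (hq0 : 0 < q) (hq1 : q < 1)
    (hq : q + q⁻¹ = 2 + μ / t ^ 2) {n : ℕ} (hn : 1 ≤ n) :
    (1 + q ^ n) / ((1 - q ^ n) * Real.sqrt (μ ^ 2 + 4 * μ * t ^ 2)) ≤ (1 + 2 * t / (n * Real.sqrt μ)) / Real.sqrt (μ ^ 2 + 4 * μ * t ^ 2) := by
  have hD : 0 < Real.sqrt (μ ^ 2 + 4 * μ * t ^ 2) := Real.sqrt_pos.mpr (by positivity)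
  have hn' : (0 : ℝ) < n := by exact_mod_cast hn
  have hsμ : 0 < Real.sqrt μ := Real.sqrt_pos.mpr hμ
  rw [show (1 + q ^ n) / ((1 - q ^ n) * Real.sqrt (μ ^ 2 + 4 * μ * t ^ 2)) =
    (1 + q ^ n) / (1 - q ^ n) / Real.sqrt (μ ^ 2 + 4 * μ * t ^ 2) by rw [div_div]]
  refine div_le_div_of_nonneg_right ?_ hD.le
  refine (one_add_pow_div_le hq0 hq1 hn).trans ?_
  have h2 := root_div_one_sub_le t ht hμ hq0 hq1 hq
  have e1 : 2 * q / (n * (1 - q)) = 2 / n * (q / (1 - q)) := by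
    have h1q : (1 - q) ≠ 0 := by linarith
    field_simp
  have e2 : 2 * t / (n * Real.sqrt μ) = 2 / n * (t / Real.sqrt μ) := by field_simp
  rw [e1, e2]
  have h2n : 0 ≤ 2 / (n : ℝ) := by positivity
  linarith [mul_le_mul_of_nonneg_left h2 h2n]

/-! ## §4 The infinite-period limit of the finite-period factor -/

/-- **THE FINITE-PERIOD FACTOR TENDS TO ONE**: for `0 ≤ q < 1`, `(1 + qⁿ)∕(1 − qⁿ) → 1` as `n → ∞` — so the source value `G(0) = (1 + qⁿ)∕((1 − qⁿ)√(μ² + 4μt²))`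
of the cycle kernel tends to the whole-line value `1∕√(μ² + 4μt²)` (= `η∕√(4μ + μ²η²)` in the units `t = η⁻¹`). [folklore] [cite: Balaban1984PropagatorsI, (1.29) p.23] -/
theorem tendsto_finitePeriod_factor {q : ℝ} (hq0 : 0 ≤ q) (hq1 : q < 1) :
    Tendsto (fun n : ℕ => (1 + q ^ n) / (1 - q ^ n)) atTop (𝓝 1) := by
  have h := tendsto_pow_atTop_nhds_zero_of_lt_one hq0 hq1
  have h1 : Tendsto (fun n : ℕ => 1 + q ^ n) atTop (𝓝 (1 + 0)) := tendsto_const_nhds.add h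
  have h2 : Tendsto (fun n : ℕ => 1 - q ^ n) atTop (𝓝 (1 - 0)) := tendsto_const_nhds.sub h
  have h3 : Tendsto (fun n : ℕ => (1 + q ^ n) / (1 - q ^ n)) atTop (𝓝 ((1 + 0) / (1 - 0))) := h1.div h2 (by norm_num)
  simpa using h3

end Literature.MathematicalPhysics.QuantumFieldTheory.Balaban1983to89.B5Eq129CycleKernelRootLetters

end
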